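import Literature.NumberTheory.LFunctions.RudnickSarnakNPrimePair
import Literature.NumberTheory.LFunctions.WeilMellinInversion
import Mathlib.MeasureTheory.Measure.Lebesgue.Basic
import Mathlib.Topology.Algebra.Module.FiniteDimension
import HarnessLib

/-!
# Rudnick–Sarnak `n`-level correlations for `ζ`, XIV: linear changes of variables on the slice

Sibling file of `Literature/NumberTheory/LFunctions/RudnickSarnak.lean` (toward
`Literature.NumberTheory.LFunctions.rudnick_sarnak_unrestricted` at every level). Tools for the
limit of the main cell integrals (Rudnick–Sarnak 1996, (3.69)–(3.74): the substitutions
`u_j = Lξ_j` on the density slots and `w = L(ξ_p + ξ_q)` on the matched pairs):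

* `RudnickSarnakN.integral_comp_linearMap` — `∫ F(A η) dη = |det A|⁻¹ ∫ F` for an invertible
  linear map of `ℝᵏ`; in particular linear involutions preserve the integral
  (`RudnickSarnakN.integral_comp_of_involutive`) and partial dilations `η_i ↦ c_i η_i` rescale
  it by `Π |c_i|⁻¹` (`RudnickSarnakN.integral_comp_diag`);
* `RudnickSarnakN.pairShear` — the linear involution `η_a ↦ −η_a − η_{π(a)}` on a set of
  matched coordinates, which turns the pair factor `K(L(η_a + η_{π a}))` into the single
  coordinate factor `K(Lη_a)`;
* the `L¹` norm of the pair kernel, `∫ K = κ(0)²` (`RudnickSarnakN.integral_Kfun`), and a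
  product bound with one bounded non-product factor (`RudnickSarnakN.integral_mul_prod_le`).

## References

* Z. Rudnick, P. Sarnak, *Zeros of principal `L`-functions and random matrix theory*, Duke Math.
  J. 81 (1996), 269–322, (3.69)–(3.74).
-/

noncomputable section

open Complex Filter Set MeasureTheory Finset
open scoped Real Topology ComplexConjugate

namespace Literature.NumberTheory.LFunctions

namespace RudnickSarnakN

variable {k : ℕ}

/-! ## Linear changes of variables in `ℝᵏ` -/

/-- **Linear change of variables**: for a linear map `A` of `ℝᵏ` with `det A ≠ 0` and any `F`,
`∫ F(A η) dη = |det A|⁻¹ ∫ F(η) dη`. [folklore] -/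
theorem integral_comp_linearMap {E : Type*} [NormedAddCommGroup E] [NormedSpace ℝ E]
    (A : (Fin k → ℝ) →ₗ[ℝ] (Fin k → ℝ)) (hA : LinearMap.det A ≠ 0) (F : (Fin k → ℝ) → E) :
    ∫ η : Fin k → ℝ, F (A η) = |(LinearMap.det A)⁻¹| • ∫ η : Fin k → ℝ, F η := by
  set e : (Fin k → ℝ) ≃ₗ[ℝ] (Fin k → ℝ) := LinearMap.equivOfDetNeZero A hA
  set em : (Fin k → ℝ) ≃ᵐ (Fin k → ℝ) := e.toContinuousLinearEquiv.toHomeomorph.toMeasurableEquiv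
  have hem : ∀ η, em η = A η := fun η ↦ rfl
  have hcoe : (em : (Fin k → ℝ) → (Fin k → ℝ)) = A := funext hem
  calc ∫ η : Fin k → ℝ, F (A η) = ∫ η : Fin k → ℝ, F (em η) := by simp_rw [hem]
    _ = ∫ η, F η ∂(Measure.map em volume) := (integral_map_equiv em F).symm
    _ = ∫ η, F η ∂(ENNReal.ofReal |(LinearMap.det A)⁻¹| • (volume : Measure (Fin k → ℝ))) := by
        rw [hcoe, Real.map_linearMap_volume_pi_eq_smul_volume_pi hA]
    _ = |(LinearMap.det A)⁻¹| • ∫ η : Fin k → ℝ, F η := by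
        rw [integral_smul_measure, ENNReal.toReal_ofReal (abs_nonneg _)]

/-- **Linear involutions preserve the integral**: if `A ∘ A = id` then `∫ F(A η) dη = ∫ F`. [folklore] -/
theorem integral_comp_of_involutive {E : Type*} [NormedAddCommGroup E] [NormedSpace ℝ E]
    (A : (Fin k → ℝ) →ₗ[ℝ] (Fin k → ℝ)) (hA : ∀ η, A (A η) = η) (F : (Fin k → ℝ) → E) :
    ∫ η : Fin k → ℝ, F (A η) = ∫ η : Fin k → ℝ, F η := by
  have hcomp : A.comp A = LinearMap.id := LinearMap.ext hA
  have hdet : LinearMap.det A * LinearMap.det A = 1 := by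
    rw [← LinearMap.det_comp, hcomp, LinearMap.det_id]
  have hne : LinearMap.det A ≠ 0 := fun h ↦ by rw [h, zero_mul] at hdet; exact zero_ne_one hdet
  have habs : |(LinearMap.det A)⁻¹| = 1 := by
    have h1 : |LinearMap.det A| = 1 := by
      have := congrArg abs hdet
      rw [abs_mul, abs_one] at this
      nlinarith [abs_nonneg (LinearMap.det A)]
    rw [abs_inv, h1, inv_one]
  rw [integral_comp_linearMap A hne, habs, one_smul]

/-- The partial dilation `η_i ↦ c_i η_i` as a linear map. [folklore] -/
def diagMap (c : Fin k → ℝ) : (Fin k → ℝ) →ₗ[ℝ] (Fin k → ℝ) := Matrix.toLin' (Matrix.diagonal c)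

/-- `diagMap c η i = c i * η i`. [folklore] -/
theorem diagMap_apply (c : Fin k → ℝ) (η : Fin k → ℝ) (i : Fin k) : diagMap c η i = c i * η i := by
  unfold diagMap
  rw [Matrix.toLin'_apply, Matrix.mulVec_diagonal]

/-- **Partial dilations**: `∫ F(c · η) dη = (Π |c_i|)⁻¹ ∫ F` for nonzero `c_i`. [folklore] -/
theorem integral_comp_diag {E : Type*} [NormedAddCommGroup E] [NormedSpace ℝ E]
    (c : Fin k → ℝ) (hc : ∀ i, c i ≠ 0) (F : (Fin k → ℝ) → E) :
    ∫ η : Fin k → ℝ, F (fun i ↦ c i * η i) = (∏ i, |c i|)⁻¹ • ∫ η : Fin k → ℝ, F η := by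
  have hdet : LinearMap.det (diagMap c) = ∏ i, c i := by
    unfold diagMap; rw [LinearMap.det_toLin', Matrix.det_diagonal]
  have hne : LinearMap.det (diagMap c) ≠ 0 := by rw [hdet]; exact Finset.prod_ne_zero_iff.2 fun i _ ↦ hc i
  have h := integral_comp_linearMap (diagMap c) hne F
  have e : (fun η : Fin k → ℝ ↦ F (diagMap c η)) = fun η ↦ F (fun i ↦ c i * η i) := by
    funext η; congr 1; funext i; exact diagMap_apply c η i
  rw [e] at h
  rw [h, hdet, abs_inv, Finset.abs_prod]

/-! ## The pair shear -/

/-- **The pair shear**: for a set `A` of coordinates with partners `π`, `η_a ↦ −η_a − η_{π a}` (`a ∈ A`),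
other coordinates fixed. [folklore] -/
def pairShear (A : Finset (Fin k)) (prt : Fin k → Fin k) : (Fin k → ℝ) →ₗ[ℝ] (Fin k → ℝ) where
  toFun η i := if i ∈ A then -η i - η (prt i) else η i
  map_add' η η' := by
    funext i
    simp only [Pi.add_apply]
    split_ifs <;> ring
  map_smul' r η := by
    funext i
    simp only [Pi.smul_apply, smul_eq_mul, RingHom.id_apply]
    split_ifs <;> ring

/-- Pointwise formula. [folklore] -/
theorem pairShear_apply (A : Finset (Fin k)) (prt : Fin k → Fin k) (η : Fin k → ℝ) (i : Fin k) :
    pairShear A prt η i = if i ∈ A then -η i - η (prt i) else η i := rfl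

/-- The pair shear is an involution when partners lie outside `A`. [folklore] -/
theorem pairShear_involutive (A : Finset (Fin k)) (prt : Fin k → Fin k) (hprt : ∀ a ∈ A, prt a ∉ A)
    (η : Fin k → ℝ) : pairShear A prt (pairShear A prt η) = η := by
  funext i
  rw [pairShear_apply]
  split_ifs with hi
  · rw [pairShear_apply, pairShear_apply, if_pos hi, if_neg (hprt i hi)]; ring
  · rw [pairShear_apply, if_neg hi]

/-- On `a ∈ A`: `(shear η)_a + (shear η)_{π a} = −η_a`. [folklore] -/
theorem pairShear_add (A : Finset (Fin k)) (prt : Fin k → Fin k) (hprt : ∀ a ∈ A, prt a ∉ A)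
    (η : Fin k → ℝ) {a : Fin k} (ha : a ∈ A) : pairShear A prt η a + pairShear A prt η (prt a) = -η a := by
  rw [pairShear_apply, pairShear_apply, if_pos ha, if_neg (hprt a ha)]; ring

/-- **The pair shear preserves integrals.** [folklore] -/
theorem integral_comp_pairShear {E : Type*} [NormedAddCommGroup E] [NormedSpace ℝ E]
    (A : Finset (Fin k)) (prt : Fin k → Fin k) (hprt : ∀ a ∈ A, prt a ∉ A) (F : (Fin k → ℝ) → E) :
    ∫ η : Fin k → ℝ, F (pairShear A prt η) = ∫ η : Fin k → ℝ, F η :=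
  integral_comp_of_involutive _ (pairShear_involutive A prt hprt) F

/-! ## The `L¹` norm of the pair kernel -/

/-- The two-variable kernel `(z, w) ↦ g₀(z) g₀(z + w)` is integrable on `ℝ²`. [folklore] -/
theorem integrable_g0R_prod : Integrable (fun p : ℝ × ℝ ↦ g0R p.1 * g0R (p.1 + p.2)) (volume.prod volume) := by
  have h1 : Integrable (fun p : ℝ × ℝ ↦ g0R p.1 * g0R p.2) (volume.prod volume) := integrable_g0R.mul_prod integrable_g0R
  have hmp : MeasurePreserving (fun p : ℝ × ℝ ↦ (p.1, p.1 + p.2)) (volume.prod volume) (volume.prod volume) :=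
    measurePreserving_prod_add (volume : Measure ℝ) (volume : Measure ℝ)
  have hemb : MeasurableEmbedding (fun p : ℝ × ℝ ↦ (p.1, p.1 + p.2)) := (MeasurableEquiv.shearAddRight ℝ).measurableEmbedding
  exact (hmp.integrable_comp_emb hemb).2 h1

/-- `K` is integrable. [folklore] -/
theorem integrable_Kfun : Integrable Kfun := by
  have h := integrable_g0R_prod.integral_prod_right
  refine h.congr (Eventually.of_forall fun w ↦ ?_)
  rfl

/-- **`∫ K = κ(0)²`.** [folklore] -/
theorem integral_Kfun : ∫ w, Kfun w = ker 0 ^ 2 := by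
  have hsw : Integrable (Function.uncurry fun (w z : ℝ) ↦ g0R z * g0R (z + w)) (volume.prod volume) := by
    have := integrable_g0R_prod.swap
    exact this.congr (Eventually.of_forall fun p ↦ rfl)
  unfold Kfun
  rw [integral_integral_swap hsw]
  have hin : ∀ z : ℝ, ∫ w, g0R z * g0R (z + w) = g0R z * ker 0 := fun z ↦ by
    rw [integral_const_mul, integral_add_left_eq_self g0R z, integral_g0R]
  simp_rw [hin]
  rw [integral_mul_const, integral_g0R, sq]

/-- `∫ K(L x) dx = κ(0)²/L`. [folklore] -/
theorem integral_Kfun_mul {L : ℝ} (hL : 0 < L) : ∫ x : ℝ, Kfun (L * x) = ker 0 ^ 2 / L := by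
  rw [MeasureTheory.Measure.integral_comp_mul_left Kfun L, integral_Kfun, abs_of_pos (inv_pos.2 hL), smul_eq_mul]
  ring

/-- `x ↦ K(L x)` is integrable. [folklore] -/
theorem integrable_Kfun_mul {L : ℝ} (hL : L ≠ 0) : Integrable fun x : ℝ ↦ Kfun (L * x) :=
  integrable_Kfun.comp_mul_left' hL

/-! ## A product bound with one bounded factor -/

/-- **Product bound with a bounded extra factor**: for nonnegative integrable `u_i` and any `R` with
`0 ≤ R ≤ R_max`, `∫ R(η) Π_i u_i(η_i) dη ≤ R_max Π_i ∫ u_i`. [folklore] -/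
theorem integral_mul_prod_le (u : Fin k → ℝ → ℝ) (hu0 : ∀ i x, 0 ≤ u i x)
    (hui : ∀ i, Integrable (u i)) {R : (Fin k → ℝ) → ℝ} {Rmax : ℝ} (hR : ∀ η, 0 ≤ R η ∧ R η ≤ Rmax) :
    ∫ η : Fin k → ℝ, R η * ∏ i, u i (η i) ≤ Rmax * ∏ i, ∫ x, u i x := by
  have hint : Integrable fun η : Fin k → ℝ ↦ ∏ i, u i (η i) := by
    have := Integrable.fintype_prod (f := u) (μ := fun _ ↦ (volume : Measure ℝ)) hui
    simpa [volume_pi] using this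
  have hprod : ∫ η : Fin k → ℝ, ∏ i, u i (η i) = ∏ i, ∫ x, u i x := integral_fintype_prod_volume_eq_prod u
  rw [← hprod, ← integral_const_mul]
  refine integral_mono_of_nonneg (Eventually.of_forall fun η ↦ mul_nonneg (hR η).1 (Finset.prod_nonneg fun i _ ↦ hu0 _ _))
    (hint.const_mul Rmax) (Eventually.of_forall fun η ↦ ?_)
  exact mul_le_mul_of_nonneg_right (hR η).2 (Finset.prod_nonneg fun i _ ↦ hu0 _ _)

/-- Integrability of `R · Π u_i(η_i)` under the same hypotheses. [folklore] -/
theorem integrable_mul_prod (u : Fin k → ℝ → ℝ)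
    (hui : ∀ i, Integrable (u i)) {R : (Fin k → ℝ) → ℝ} (hRm : AEStronglyMeasurable R volume) {Rmax : ℝ}
    (hR : ∀ η, 0 ≤ R η ∧ R η ≤ Rmax) :
    Integrable fun η : Fin k → ℝ ↦ R η * ∏ i, u i (η i) := by
  have hint : Integrable fun η : Fin k → ℝ ↦ ∏ i, u i (η i) := by
    have := Integrable.fintype_prod (f := u) (μ := fun _ ↦ (volume : Measure ℝ)) hui
    simpa [volume_pi] using this
  refine hint.bdd_mul (c := Rmax) hRm (Eventually.of_forall fun η ↦ ?_)
  rw [Real.norm_eq_abs, abs_of_nonneg (hR η).1]; exact (hR η).2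

/-! ## Splitting the coordinates -/

/-- **Splitting an integral over `ℝᵏ` along a predicate on the coordinates**: for functions of the
`p`-coordinates and of the other coordinates, `∫ F(η|_p) G(η|_{¬p}) dη = (∫ F)(∫ G)`. [folklore] -/
theorem integral_mul_split (p : Fin k → Prop) [DecidablePred p] (F : ({i // p i} → ℝ) → ℂ)
    (G : ({i // ¬ p i} → ℝ) → ℂ) :
    ∫ η : Fin k → ℝ, F (fun i ↦ η i) * G (fun i ↦ η i) =
      (∫ x : {i // p i} → ℝ, F x) * ∫ y : {i // ¬ p i} → ℝ, G y := by
  have hmp := volume_preserving_piEquivPiSubtypeProd (fun _ : Fin k ↦ ℝ) p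
  have h := hmp.integral_comp (MeasurableEquiv.measurableEmbedding _) (fun z : ({i // p i} → ℝ) × ({i // ¬ p i} → ℝ) ↦ F z.1 * G z.2)
  simp only [MeasurableEquiv.piEquivPiSubtypeProd, MeasurableEquiv.coe_mk, Equiv.piEquivPiSubtypeProd_apply] at h
  rw [h]
  exact integral_prod_mul F G

/-! ## Fourier representation of product integrals through a linear form -/

/-- **Fourier product formula**: if `2π g(v) = ∫ G(y) e^{−iyv} dy` with `G` integrable and continuous,
then for continuous integrable `f_i` and signs/scalars `s_i`,
`∫_{x ∈ ℝᵐ} Π_i f_i(x_i) · g(Σ_i s_i x_i) dx = (2π)⁻¹ ∫_y G(y) Π_i (∫ f_i(x) e^{−iy s_i x} dx) dy`. [folklore] -/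
theorem integral_prod_mul_comp_sum {m : ℕ} (f : Fin m → ℝ → ℂ) (hfc : ∀ i, Continuous (f i))
    (hfi : ∀ i, Integrable (f i)) (s : Fin m → ℝ) {g G : ℝ → ℂ} (hGc : Continuous G) (hGi : Integrable G)
    (hg : ∀ v : ℝ, 2 * π * g v = ∫ y : ℝ, G y * cexp (-(y * I) * v)) :
    ∫ x : Fin m → ℝ, (∏ i, f i (x i)) * g (∑ i, s i * x i) =
      (2 * (π : ℂ))⁻¹ * ∫ y : ℝ, G y * ∏ i, ∫ x : ℝ, f i x * cexp (-(y * I) * (s i * x)) := by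
  have hπ : (2 * (π : ℂ)) ≠ 0 := by norm_num [Real.pi_ne_zero]
  have hg' : ∀ v : ℝ, g v = (2 * (π : ℂ))⁻¹ * ∫ y : ℝ, G y * cexp (-(y * I) * v) := fun v ↦ by
    rw [← hg v, ← mul_assoc, inv_mul_cancel₀ hπ, one_mul]
  -- the joint integrand
  set Φ2 : (Fin m → ℝ) × ℝ → ℂ := fun p ↦ (∏ i, f i (p.1 i)) * (G p.2 * cexp (-(p.2 * I) * (∑ i, s i * p.1 i : ℝ)))
  have hprodint : Integrable (fun x : Fin m → ℝ ↦ ∏ i, f i (x i)) := by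
    have := Integrable.fintype_prod (f := f) (μ := fun _ ↦ (volume : Measure ℝ)) hfi
    simpa [volume_pi] using this
  have hΦ2 : Integrable Φ2 ((volume : Measure (Fin m → ℝ)).prod (volume : Measure ℝ)) := by
    have h1 : Integrable (fun p : (Fin m → ℝ) × ℝ ↦ (∏ i, f i (p.1 i)) * G p.2) ((volume : Measure (Fin m → ℝ)).prod volume) :=
      hprodint.mul_prod hGi
    refine h1.norm.mono' ?_ (Eventually.of_forall fun p ↦ ?_)
    · refine Continuous.aestronglyMeasurable ?_
      simp only [Φ2]
      refine Continuous.mul (continuous_finsetProd _ fun i _ ↦ (hfc i).comp ((continuous_apply i).comp continuous_fst))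
        (Continuous.mul (hGc.comp continuous_snd) (Complex.continuous_exp.comp ?_))
      refine Continuous.mul (by fun_prop) (Complex.continuous_ofReal.comp ?_)
      exact continuous_finsetSum _ fun i _ ↦ continuous_const.mul ((continuous_apply i).comp continuous_fst)
    · simp only [Φ2, norm_mul]
      rw [show -(↑p.2 * I) * ((∑ i, s i * p.1 i : ℝ) : ℂ) = ((-(p.2 * ∑ i, s i * p.1 i) : ℝ) : ℂ) * I by push_cast; ring,
        Complex.norm_exp_ofReal_mul_I, mul_one]
  calc ∫ x : Fin m → ℝ, (∏ i, f i (x i)) * g (∑ i, s i * x i)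
      = ∫ x : Fin m → ℝ, (2 * (π : ℂ))⁻¹ * ∫ y : ℝ, Φ2 (x, y) := by
        refine integral_congr_ae (ae_of_all _ fun x ↦ ?_)
        dsimp only
        rw [hg']
        simp only [Φ2]
        rw [integral_const_mul]
        ring
    _ = (2 * (π : ℂ))⁻¹ * ∫ x : Fin m → ℝ, ∫ y : ℝ, Φ2 (x, y) := integral_const_mul _ _
    _ = (2 * (π : ℂ))⁻¹ * ∫ y : ℝ, ∫ x : Fin m → ℝ, Φ2 (x, y) := by rw [integral_integral_swap hΦ2]
    _ = (2 * (π : ℂ))⁻¹ * ∫ y : ℝ, G y * ∏ i, ∫ x : ℝ, f i x * cexp (-(y * I) * (s i * x)) := by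
        congr 1
        refine integral_congr_ae (ae_of_all _ fun y ↦ ?_)
        dsimp only
        simp only [Φ2]
        have e : ∀ x : Fin m → ℝ, (∏ i, f i (x i)) * (G y * cexp (-(y * I) * (∑ i, s i * x i : ℝ))) =
            G y * ∏ i, (f i (x i) * cexp (-(y * I) * (s i * x i))) := by
          intro x
          rw [Finset.prod_mul_distrib, ← Complex.exp_sum]
          push_cast
          rw [Finset.mul_sum]
          ring
        simp_rw [e]
        rw [integral_const_mul]
        congr 1
        exact integral_fintype_prod_volume_eq_prod (fun i (x : ℝ) ↦ f i x * cexp (-(y * I) * (s i * x)))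

/-! ## The kernels `g₀`, `K` and their transforms -/

/-- `K` as the (complex) Weil convolution `g₀ ⋆ g₀~`. [folklore] -/
def Kc : ℝ → ℂ := weilConv g0 (weilReflect g0)

/-- `Kc` is a Weil test function. [folklore] -/
theorem Kc_isWeilTest : IsWeilTest Kc := g0_isWeilTest.weilConv g0_isWeilTest.weilReflect

/-- `Kc(w) = K(w)`. [folklore] -/
theorem Kc_eq (w : ℝ) : Kc w = ((Kfun w : ℝ) : ℂ) := by
  unfold Kc
  rw [weilConv_apply]
  have e : ∀ u : ℝ, g0 u * weilReflect g0 (w - u) = (((g0R u * g0R (u - w)) : ℝ) : ℂ) := by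
    intro u
    unfold weilReflect
    rw [show -(w - u) = u - w by ring, conj_g0, g0_eq_re u, g0_eq_re (u - w)]
    push_cast
    rfl
  simp_rw [e]
  rw [integral_complex_ofReal]
  congr 1
  unfold Kfun
  rw [← integral_sub_right_eq_self (fun z ↦ g0R z * g0R (z + w)) w]
  congr 1 with u
  rw [show u - w + w = u by ring, mul_comm]

/-- `K̂(1/2 + ir) = κ(r)²`. [folklore] -/
theorem weilMellin_Kc_half (r : ℝ) : weilMellin Kc (1 / 2 + r * I) = ((ker r ^ 2 : ℝ) : ℂ) := by
  unfold Kc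
  rw [weilMellin_weilConv_holds g0_isWeilTest.1.continuous g0_isWeilTest.2
    g0_isWeilTest.weilReflect.1.continuous g0_isWeilTest.weilReflect.2, weilMellin_weilReflect_holds,
    show 1 - conj (1 / 2 + (r : ℂ) * I) = 1 / 2 + r * I by
      rw [map_add, map_mul, Complex.conj_ofReal, Complex.conj_I, map_div₀, map_one, map_ofNat]; ring,
    weilMellin_g0_half]
  rw [Complex.conj_ofReal]; push_cast; ring

/-- The Fourier integral of `g0R`: `∫ g₀(x) e^{−iy s x} dx = κ(−sy) = κ(sy)`. [folklore] -/
theorem integral_g0R_mul_cexp (y s : ℝ) :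
    ∫ x : ℝ, ((g0R x : ℝ) : ℂ) * cexp (-(y * I) * (s * x)) = (ker (s * y) : ℂ) := by
  rw [← ker_neg, ker_eq_integral]
  refine integral_congr_ae (ae_of_all _ fun x ↦ ?_)
  dsimp only
  rw [show ((g0R x : ℝ) : ℂ) = g0 x from (g0_eq_re x).symm]
  congr 1
  push_cast; ring_nf

/-- The Fourier integral of `K`: `∫ K(x) e^{−iy s x} dx = κ(sy)²`. [folklore] -/
theorem integral_Kfun_mul_cexp (y s : ℝ) :
    ∫ x : ℝ, ((Kfun x : ℝ) : ℂ) * cexp (-(y * I) * (s * x)) = ((ker (s * y) ^ 2 : ℝ) : ℂ) := by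
  have h := weilMellin_Kc_half (-(s * y))
  unfold weilMellin at h
  rw [show ker (-(s * y)) = ker (s * y) from ker_neg _] at h
  rw [← h]
  refine integral_congr_ae (ae_of_all _ fun x ↦ ?_)
  dsimp only
  rw [Kc_eq]
  congr 1
  push_cast; ring_nf

/-- Inversion for `g0R`: `2π g₀(v) = ∫ κ(y) e^{−iyv} dy`. [folklore] -/
theorem two_pi_mul_g0R (v : ℝ) : 2 * π * ((g0R v : ℝ) : ℂ) = ∫ y : ℝ, (ker y : ℂ) * cexp (-(y * I) * v) := by
  have h := weilMellin_inversion g0_isWeilTest (1 / 2) v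
  have e2 : cexp (((((1 / 2 : ℝ)) : ℂ) - 1 / 2) * (v : ℂ)) = 1 := by
    rw [show ((((1 / 2 : ℝ)) : ℂ) - 1 / 2) = 0 by push_cast; ring]; simp
  rw [e2, mul_one] at h
  have e : ∀ y : ℝ, weilMellin g0 (((1 / 2 : ℝ)) + y * I) = (ker y : ℂ) := fun y ↦ by
    rw [show (((1 / 2 : ℝ)) : ℂ) = 1 / 2 by push_cast; ring]; exact weilMellin_g0_half y
  simp_rw [e] at h
  rw [h, show ((g0R v : ℝ) : ℂ) = g0 v from (g0_eq_re v).symm]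

/-- Inversion for `K`: `2π K(v) = ∫ κ(y)² e^{−iyv} dy`. [folklore] -/
theorem two_pi_mul_Kfun (v : ℝ) : 2 * π * ((Kfun v : ℝ) : ℂ) = ∫ y : ℝ, ((ker y ^ 2 : ℝ) : ℂ) * cexp (-(y * I) * v) := by
  have h := weilMellin_inversion Kc_isWeilTest (1 / 2) v
  have e2 : cexp (((((1 / 2 : ℝ)) : ℂ) - 1 / 2) * (v : ℂ)) = 1 := by
    rw [show ((((1 / 2 : ℝ)) : ℂ) - 1 / 2) = 0 by push_cast; ring]; simp
  rw [e2, mul_one] at h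
  have e : ∀ y : ℝ, weilMellin Kc (((1 / 2 : ℝ)) + y * I) = ((ker y ^ 2 : ℝ) : ℂ) := fun y ↦ by
    rw [show (((1 / 2 : ℝ)) : ℂ) = 1 / 2 by push_cast; ring]; exact weilMellin_Kc_half y
  simp_rw [e] at h
  rw [h, Kc_eq]

/-- `y ↦ κ(y)ⁿ` is continuous and integrable for `n ≥ 1`. [folklore] -/
theorem integrable_ker_pow {n : ℕ} (hn : 1 ≤ n) : Integrable fun y : ℝ ↦ ker y ^ n := by
  obtain ⟨C, hC0, hC⟩ := exists_ker_le
  have h1 : Integrable fun y : ℝ ↦ ker y := by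
    refine (integrable_inv_one_add_sq.const_mul C).mono' continuous_ker.aestronglyMeasurable (Eventually.of_forall fun y ↦ ?_)
    rw [Real.norm_of_nonneg (ker_nonneg _)]
    refine (hC y).trans ?_
    rw [← div_eq_mul_inv]
    refine div_le_div_of_nonneg_left hC0.le (by positivity) ?_
    nlinarith [sq_nonneg y, sq_nonneg (y ^ 2)]
  refine (h1.const_mul (ker 0 ^ (n - 1))).mono' ((continuous_ker.pow n).aestronglyMeasurable) (Eventually.of_forall fun y ↦ ?_)
  rw [Real.norm_of_nonneg (pow_nonneg (ker_nonneg _) _)]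
  calc ker y ^ n = ker y ^ (n - 1) * ker y := by rw [← pow_succ]; congr 1; omega
    _ ≤ ker 0 ^ (n - 1) * ker y := mul_le_mul_of_nonneg_right (pow_le_pow_left₀ (ker_nonneg _) (ker_le_ker_zero _) _) (ker_nonneg _)

/-! ## The universal level constant -/

/-- **The level constant** `c_n = (2π)⁻¹ ∫ κ(y)ⁿ dy` (`= g₀^{⋆n}(0)`; it reappears in the unsmoothing as
`(2π)⁻¹ ∫ κⁿ`). [cite: RudnickSarnak1996, (3.74)] -/
def levelConst (n : ℕ) : ℝ := (2 * π)⁻¹ * ∫ y : ℝ, ker y ^ n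

/-- The kernel attached to a slot type: `g₀` (weight 1) or `K` (weight 2). [folklore] -/
def slotKer (isK : Bool) : ℝ → ℝ := if isK then Kfun else g0R

/-- Its weight. [folklore] -/
def slotWt (isK : Bool) : ℕ := if isK then 2 else 1

/-- `slotKer` is continuous, integrable, and has transform `κ(sy)^{wt}`. [folklore] -/
theorem slotKer_props (isK : Bool) :
    Continuous (slotKer isK) ∧ Integrable (slotKer isK) ∧
      (∀ y s : ℝ, ∫ x : ℝ, ((slotKer isK x : ℝ) : ℂ) * cexp (-(y * I) * (s * x)) = ((ker (s * y) ^ slotWt isK : ℝ) : ℂ)) ∧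
      (∀ v : ℝ, 2 * π * ((slotKer isK v : ℝ) : ℂ) = ∫ y : ℝ, ((ker y ^ slotWt isK : ℝ) : ℂ) * cexp (-(y * I) * v)) := by
  cases isK
  · simp only [slotKer, slotWt, Bool.false_eq_true, if_false, pow_one]
    exact ⟨contDiff_g0R.continuous, integrable_g0R, integral_g0R_mul_cexp, two_pi_mul_g0R⟩
  · simp only [slotKer, slotWt, if_true]
    exact ⟨continuous_Kfun, integrable_Kfun, integral_Kfun_mul_cexp, two_pi_mul_Kfun⟩

/-- **All pattern constants are the level constant**: for slot types `isK_i` with signs `s_i = ±1` and a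
final slot type `isK₀`,
`∫_{x∈ℝᵐ} Π_i φ_i(x_i) φ₀(Σ s_i x_i) dx = c_n`, `n = Σ_i wt_i + wt₀`. [cite: RudnickSarnak1996, (3.74)] -/
theorem integral_prod_slotKer_eq_levelConst {m : ℕ} (isK : Fin m → Bool) (isK₀ : Bool) (s : Fin m → ℝ)
    (hs : ∀ i, s i = 1 ∨ s i = -1) :
    ∫ x : Fin m → ℝ, (∏ i, slotKer (isK i) (x i)) * slotKer isK₀ (∑ i, s i * x i) =
      levelConst (∑ i, slotWt (isK i) + slotWt isK₀) := by
  -- complexify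
  have hreal : (((∫ x : Fin m → ℝ, (∏ i, slotKer (isK i) (x i)) * slotKer isK₀ (∑ i, s i * x i) : ℝ)) : ℂ) =
      ∫ x : Fin m → ℝ, (∏ i, ((slotKer (isK i) (x i) : ℝ) : ℂ)) * ((slotKer isK₀ (∑ i, s i * x i) : ℝ) : ℂ) := by
    rw [← integral_complex_ofReal]
    refine integral_congr_ae (ae_of_all _ fun x ↦ ?_)
    push_cast; rfl
  obtain ⟨h0c, h0i, -, h0inv⟩ := slotKer_props isK₀
  have hmain := integral_prod_mul_comp_sum (fun i ↦ fun x : ℝ ↦ ((slotKer (isK i) x : ℝ) : ℂ))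
    (fun i ↦ Complex.continuous_ofReal.comp (slotKer_props (isK i)).1)
    (fun i ↦ (slotKer_props (isK i)).2.1.ofReal) s (g := fun v ↦ ((slotKer isK₀ v : ℝ) : ℂ))
    (G := fun y ↦ ((ker y ^ slotWt isK₀ : ℝ) : ℂ))
    (Complex.continuous_ofReal.comp (continuous_ker.pow _))
    ((integrable_ker_pow (by unfold slotWt; split_ifs <;> norm_num)).ofReal) h0inv
  have htrans : ∀ y : ℝ, ∏ i, ∫ x : ℝ, ((slotKer (isK i) x : ℝ) : ℂ) * cexp (-(y * I) * (s i * x)) =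
      ((ker y ^ ∑ i, slotWt (isK i) : ℝ) : ℂ) := by
    intro y
    rw [Finset.prod_congr rfl fun i _ ↦ (slotKer_props (isK i)).2.2.1 y (s i)]
    push_cast
    rw [← Finset.prod_pow_eq_pow_sum]
    refine Finset.prod_congr rfl fun i _ ↦ ?_
    rcases hs i with h | h
    · rw [h, one_mul]
    · rw [h, neg_one_mul, ker_neg]
  simp_rw [htrans] at hmain
  apply Complex.ofReal_injective
  rw [hreal, hmain]
  unfold levelConst
  push_cast
  rw [← integral_complex_ofReal]
  congr 1
  refine integral_congr_ae (ae_of_all _ fun y ↦ ?_)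
  push_cast
  ring

end RudnickSarnakN

end Literature.NumberTheory.LFunctions

end
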